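import Summits.AnomalousDissipation.AnomalousDissipation.Theorems.MarginalStabilityChainChainRealisationReduction
import Summits.AnomalousDissipation.AnomalousDissipation.Theorems.MarginalStabilityChainChainRealisationDomination
import HarnessLib

/-!
# Crux-triage round 2, triager 2 — kernel anchors for `TRIAGE-r2-2.md`
(crux stmt-AnomalousDissipation-14249 `MarginalStabilityChain.ChainRealisation`)

Both round-2 "ideas" (`crux` by ideator 4, `none` by ideator 5) are ZERO-CARD reports.  The anchors below are the
tree facts their common argument rests on, re-checked from this seat against the current tree:
* T1 two doors (p111632): `ChainRealisation ↔ (¬ StrainedLayerLaw ∨ ChainThesis)`;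
* T2 domination (p111632/p116771): under `StrainedLayerLaw` the crux IS the route target, and every residual `R`
  closes the crux iff it proves the target;
* T3 the `⊤`-dichotomy of the `ℝ≥0∞` Cesàro floor (independent re-derivation, generic density): a member of
  stmt-3007's bare class with an infinite-dissipation window meets every floor, so non-uniqueness ghosts sit on the
  TRUE side of `StrainedLayerLaw` and cannot open door (a).
-/

set_option linter.dupNamespace false

noncomputable section

open Set Filter MeasureTheory
open scoped ENNReal Topology

namespace Summit.AnomalousDissipation.AnomalousDissipation.Cruxes.ChainRealisation.TriageR2K2

open Summit.AnomalousDissipation.AnomalousDissipation.Theses.MarginalStabilityChain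
open Summit.AnomalousDissipation.AnomalousDissipation.Theorems.ChainRealisation

/-- T1: the two doors, as of this check (3008 and 3009 are theorems of the tree). [folklore] -/
example : ChainRealisation ↔ (¬ StrainedLayerLaw ∨ ChainThesis) := Reduction.chainRealisation_iff_not_or

/-- T2a: granted the single-layer law, the crux is literally the route target. [folklore] -/
example (h2 : StrainedLayerLaw) : ChainRealisation ↔ ChainThesis :=
  Reduction.chainRealisation_iff_chainThesis_of h2

/-- T2b: every residual of every non-(a) line is a stmt-3005 residual. [folklore] -/
example (R : Prop) (h2 : StrainedLayerLaw) : (R → ChainRealisation) ↔ (R → ChainThesis) :=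
  SeparatrixFluxPinning.chainRealisation_residual_iff R h2

/-- T2c: a "line" with NO lever (residual `True`) is exactly a proof of the target, granted 3007. [folklore] -/
example (h2 : StrainedLayerLaw) : (True → ChainRealisation) ↔ (True → ChainThesis) :=
  SeparatrixFluxPinning.chainRealisation_residual_iff True h2

/-- T3: `⊤`-dichotomy of a Cesàro floor in `ℝ≥0∞` (generic density `D`; independent re-derivation of
`Ideator4R2.floor_of_setLIntegral_eq_top` / `Ideator5.floor_of_window`). [folklore] -/
theorem floor_of_top_window {D : ℝ → ℝ≥0∞} {b : ℝ} (hb : 0 < b)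
    (h : ∫⁻ t in Ioc 0 b, D t = ⊤) (K : ℝ≥0∞) :
    K ≤ liminf (fun T : ℝ => ENNReal.ofReal T⁻¹ * ∫⁻ t in Ioc 0 T, D t) atTop := by
  suffices hlim : liminf (fun T : ℝ => ENNReal.ofReal T⁻¹ * ∫⁻ t in Ioc 0 T, D t) atTop = ⊤ by
    rw [hlim]; exact le_top
  have hev : ∀ᶠ T in atTop,
      (fun T : ℝ => ENNReal.ofReal T⁻¹ * ∫⁻ t in Ioc 0 T, D t) T = (fun _ : ℝ => (⊤ : ℝ≥0∞)) T := by
    filter_upwards [eventually_ge_atTop b] with T hbT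
    have hT : 0 < T := hb.trans_le hbT
    have hmono : ∫⁻ t in Ioc 0 b, D t ≤ ∫⁻ t in Ioc 0 T, D t :=
      lintegral_mono_set (Ioc_subset_Ioc_right hbT)
    have htop : ∫⁻ t in Ioc 0 T, D t = ⊤ := top_unique (h ▸ hmono)
    have h0 : ENNReal.ofReal T⁻¹ ≠ 0 := (ENNReal.ofReal_pos.2 (inv_pos.2 hT)).ne'
    show ENNReal.ofReal T⁻¹ * ∫⁻ t in Ioc 0 T, D t = ⊤
    rw [htop, ENNReal.mul_top h0]
  rw [liminf_congr hev, liminf_const]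

end Summit.AnomalousDissipation.AnomalousDissipation.Cruxes.ChainRealisation.TriageR2K2

end
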